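import Literature.NumberTheory.GaloisRepresentations.LubinTateUnramifiedFrobenius
import HarnessLib

/-!
# Functoriality of `τ_E`, `𝒮_E`, `𝒩_E` and of the twisted lift in the coefficient field `E` (`q = 2`)

Setting of `LubinTateColemanRelativeTraceTwo` / `…RelativeLiftTwo` / `LubinTateUnramifiedFrobenius`:
`F` a non-archimedean local field with `q = 2`, uniformiser `π`, `f = πX + X²`, and finite subextensions
`E, E₁ ≤ E₂` of `F̄` with valuation rings `𝒪_E = unitBall E`.  The operators `τ_E h = h(−π−X)`,
`𝒮_E`, `𝒩_E` on `𝒪_E⟦X⟧` are defined coefficient-field by coefficient-field; this file records that they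
commute with EVERY ring homomorphism of coefficient rings `ψ : 𝒪_{E₁} → 𝒪_{E₂}` fixing `π` — in
particular with the inclusions `𝒪_{E₁} → 𝒪_{E₂}` (`inclUnitBall`) and with the Frobenius automorphisms —
and deduces the base-change property of de Shalit's twisted lift `𝒩_E G = G^φ`:

* `ringHom_map_subst_map_ltSer`, `ringHom_map_reflE`, `ringHom_map_relTraceTwo`, `ringHom_map_relNormTwo` —
  `(R ∘ f)^ψ = R^ψ ∘ f`, `(τ G)^ψ = τ (G^ψ)`, `(𝒮 G)^ψ = 𝒮 (G^ψ)`, `(𝒩 G)^ψ = 𝒩 (G^ψ)` for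
  `ψ : 𝒪_{E₁} →+* 𝒪_{E₂}` with `ψ(π) = π` (the endomorphism case is `map_relNormTwo` etc. of
  `LubinTateColemanRelativeCongruenceTwo`);
* `relNormTwo_map_inclUnitBall`, `relTraceTwo_map_inclUnitBall` — `𝒩_{E₂} (ι G) = ι (𝒩_{E₁} G)` for `E₁ ≤ E₂`;
* `relNormTwo_map_inclUnitBall_eq_map_frobenius` — if `𝒩_{E₁} G = G^{φ_{E₁}}` then
  `𝒩_{E₂} (ι G) = (ι G)^{φ_{E₂}}` (`E₁ ≤ E₂` normal over `F`, `φ` the restrictions of one `σ₀ ∈ Γ_F`);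
* ★ `frobeniusLift_map_inclUnitBall` — **base change of the twisted lift**: for `E₁ ≤ E₂ ≤ F^{nr}` and an
  arithmetic Frobenius `σ₀`, if `G₁` is the `φ`-twisted `𝒩_{E₁}`-invariant unit lift of `g` and `G₂` the
  `φ`-twisted `𝒩_{E₂}`-invariant unit lift of `ι g`, then `G₂ = ι G₁` (uniqueness of the lift over `E₂`).
* `isUnit_of_sub_mem_coeffIdeal_span` (generic: congruent mod `p` to a unit ⇒ unit, `S` `(p)`-adically
  complete); ★ `existsUnique_isUnit_relNormTwo_eq_map`, `existsUnique_isUnit_relNormTwo_eq_map_frobenius` —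
  the twisted lift as a UNIQUE UNIT: `∃! G` unit, `𝒩_E G = G^φ`, `G ≡ g (mod π)`.

References: E. de Shalit, *Iwasawa theory of elliptic curves with complex multiplication* (1987), Ch. I
§2.1 (functoriality of `𝒩` in the coefficient ring), §3.10; Ch. III §1.3 (induction over unramified `k'`).
-/

noncomputable section

open scoped PowerSeries.WithPiTopology

namespace Literature.NumberTheory.GaloisRepresentations

section RelativeFunctorial

open GaloisRepresentations.IsNonarchimedeanLocalField LubinTate ValuativeRel Field

variable (F : Type*) [Field F] [ValuativeRel F] [TopologicalSpace F] [IsNonarchimedeanLocalField F]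

attribute [local instance] ltNormUniformSpace ltNormIsUniformAddGroup rk1 nF nE fintypeResidueField

variable {F}
variable {π : 𝒪[F]} (hπ : (valuation F).IsUniformizer (π : F))
variable {E₁ E₂ : IntermediateField F (AlgebraicClosure F)} [FiniteDimensional F E₁] [FiniteDimensional F E₂]

/-- `f` is substitutable over `𝒪_E` (`f(0) = 0`). [folklore] -/
private theorem hasSubst_mapLtSer₅ (E : IntermediateField F (AlgebraicClosure F)) [FiniteDimensional F E] :
    PowerSeries.HasSubst ((ltSer F π).map (algebraMap (LTCoeff F) (unitBall E))) :=
  PowerSeries.HasSubst.of_constantCoeff_zero' ((isLTSeries_ltSer π).map _).constantCoeff_eq_zero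

/-! ### Ring homomorphisms of coefficient rings fixing `π` -/

/-- `f^ψ = f` for `ψ : 𝒪_{E₁} → 𝒪_{E₂}` fixing `π` (`f = πX + X^q`). [cite: deShalit1987, Ch. I §2.1] -/
theorem map_map_ltSer_of_map_pi {ψ : unitBall E₁ →+* unitBall E₂}
    (hψ : ψ (algebraMap 𝒪[F] (unitBall E₁) π) = algebraMap 𝒪[F] (unitBall E₂) π) :
    ((ltSer F π).map (algebraMap (LTCoeff F) (unitBall E₁))).map ψ =
      (ltSer F π).map (algebraMap (LTCoeff F) (unitBall E₂)) := by
  have e : ltSer F π = PowerSeries.C (LTCoeff.of F π) * PowerSeries.X + PowerSeries.X ^ residueFieldCard F := by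
    change ((ltPoly F π : Polynomial 𝒪[F]) : PowerSeries 𝒪[F]) = _
    rw [ltPoly, Polynomial.coe_add, Polynomial.coe_mul, Polynomial.coe_pow, Polynomial.coe_C, Polynomial.coe_X]
    rfl
  rw [e, map_add, map_mul, map_pow, PowerSeries.map_C, PowerSeries.map_X, map_add, map_mul, map_pow,
    PowerSeries.map_C, PowerSeries.map_X, map_add, map_mul, map_pow, PowerSeries.map_C, PowerSeries.map_X]
  change PowerSeries.C (ψ (algebraMap 𝒪[F] (unitBall E₁) π)) * _ + _ = _
  rw [hψ]
  rfl

/-- `(R ∘ f)^ψ = R^ψ ∘ f` for a ring homomorphism `ψ : 𝒪_{E₁} → 𝒪_{E₂}` fixing `π`.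
[cite: deShalit1987, Ch. I §2.1] -/
theorem ringHom_map_subst_map_ltSer {ψ : unitBall E₁ →+* unitBall E₂}
    (hψ : ψ (algebraMap 𝒪[F] (unitBall E₁) π) = algebraMap 𝒪[F] (unitBall E₂) π) (R : PowerSeries (unitBall E₁)) :
    PowerSeries.map ψ (PowerSeries.subst ((ltSer F π).map (algebraMap (LTCoeff F) (unitBall E₁))) R) =
      PowerSeries.subst ((ltSer F π).map (algebraMap (LTCoeff F) (unitBall E₂))) (PowerSeries.map ψ R) := by
  have e : PowerSeries.map ψ (PowerSeries.subst ((ltSer F π).map (algebraMap (LTCoeff F) (unitBall E₁))) R) =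
      PowerSeries.subst (((ltSer F π).map (algebraMap (LTCoeff F) (unitBall E₁))).map ψ) (PowerSeries.map ψ R) :=
    PowerSeries.map_subst (hasSubst_mapLtSer₅ E₁) R
  rw [e, map_map_ltSer_of_map_pi hψ]

/-- ★ **`(τ_{E₁} G)^ψ = τ_{E₂} (G^ψ)`** for `ψ : 𝒪_{E₁} → 𝒪_{E₂}` fixing `π`: with `G = R₀ ∘ f + X·(R₁ ∘ f)`
both sides are `R₀^ψ ∘ f + (−π − X)·(R₁^ψ ∘ f)`. [cite: deShalit1987, Ch. I §2.1] -/
theorem ringHom_map_reflE (hq : residueFieldCard F = 2) {ψ : unitBall E₁ →+* unitBall E₂}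
    (hψ : ψ (algebraMap 𝒪[F] (unitBall E₁) π) = algebraMap 𝒪[F] (unitBall E₂) π) (G : PowerSeries (unitBall E₁)) :
    PowerSeries.map ψ (reflE hπ E₁ G) = reflE hπ E₂ (PowerSeries.map ψ G) := by
  obtain ⟨R₀, R₁, hG⟩ := exists_eq_subst_add_X_mul_subst_E hπ E₁ hq G
  have e1 : PowerSeries.map ψ (reflE hπ E₁ G) =
      PowerSeries.subst ((ltSer F π).map (algebraMap (LTCoeff F) (unitBall E₂))) (PowerSeries.map ψ R₀) +
        (-PowerSeries.X - PowerSeries.C (algebraMap 𝒪[F] (unitBall E₂) π)) *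
          PowerSeries.subst ((ltSer F π).map (algebraMap (LTCoeff F) (unitBall E₂))) (PowerSeries.map ψ R₁) := by
    rw [hG, map_add, map_mul, reflE_X hπ E₁ hq, reflE_subst hπ E₁ hq, reflE_subst hπ E₁ hq, map_add, map_mul, map_sub,
      map_neg, PowerSeries.map_X, PowerSeries.map_C, hψ, ringHom_map_subst_map_ltSer hψ, ringHom_map_subst_map_ltSer hψ]
  have e2 : PowerSeries.map ψ G =
      PowerSeries.subst ((ltSer F π).map (algebraMap (LTCoeff F) (unitBall E₂))) (PowerSeries.map ψ R₀) +
      PowerSeries.X * PowerSeries.subst ((ltSer F π).map (algebraMap (LTCoeff F) (unitBall E₂))) (PowerSeries.map ψ R₁) := by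
    rw [hG, map_add, map_mul, PowerSeries.map_X, ringHom_map_subst_map_ltSer hψ, ringHom_map_subst_map_ltSer hψ]
  rw [e1, e2, map_add, map_mul, reflE_X hπ E₂ hq, reflE_subst hπ E₂ hq, reflE_subst hπ E₂ hq]

/-- ★ **`(𝒮_{E₁} G)^ψ = 𝒮_{E₂} (G^ψ)`** for `ψ : 𝒪_{E₁} → 𝒪_{E₂}` fixing `π`. [cite: deShalit1987, Ch. I §3.12] -/
theorem ringHom_map_relTraceTwo (hq : residueFieldCard F = 2) {ψ : unitBall E₁ →+* unitBall E₂}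
    (hψ : ψ (algebraMap 𝒪[F] (unitBall E₁) π) = algebraMap 𝒪[F] (unitBall E₂) π) (G : PowerSeries (unitBall E₁)) :
    PowerSeries.map ψ (relTraceTwo hπ E₁ hq G) = relTraceTwo hπ E₂ hq (PowerSeries.map ψ G) := by
  refine subst_map_ltSer_injective hπ E₂ ?_
  change PowerSeries.subst ((ltSer F π).map (algebraMap (LTCoeff F) (unitBall E₂))) (PowerSeries.map ψ (relTraceTwo hπ E₁ hq G)) =
    PowerSeries.subst ((ltSer F π).map (algebraMap (LTCoeff F) (unitBall E₂))) (relTraceTwo hπ E₂ hq (PowerSeries.map ψ G))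
  have e1 : PowerSeries.subst ((ltSer F π).map (algebraMap (LTCoeff F) (unitBall E₂)))
      (PowerSeries.map ψ (relTraceTwo hπ E₁ hq G)) = PowerSeries.map ψ (G + reflE hπ E₁ G) := by
    rw [← ringHom_map_subst_map_ltSer hψ, subst_relTraceTwo]
  rw [e1, subst_relTraceTwo, (PowerSeries.map ψ).map_add, ringHom_map_reflE hπ hq hψ]

/-- ★ **`(𝒩_{E₁} G)^ψ = 𝒩_{E₂} (G^ψ)`** for `ψ : 𝒪_{E₁} → 𝒪_{E₂}` fixing `π`. [cite: deShalit1987, Ch. I §2.1] -/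
theorem ringHom_map_relNormTwo (hq : residueFieldCard F = 2) {ψ : unitBall E₁ →+* unitBall E₂}
    (hψ : ψ (algebraMap 𝒪[F] (unitBall E₁) π) = algebraMap 𝒪[F] (unitBall E₂) π) (G : PowerSeries (unitBall E₁)) :
    PowerSeries.map ψ (relNormTwo hπ E₁ hq G) = relNormTwo hπ E₂ hq (PowerSeries.map ψ G) := by
  refine subst_map_ltSer_injective hπ E₂ ?_
  change PowerSeries.subst ((ltSer F π).map (algebraMap (LTCoeff F) (unitBall E₂))) (PowerSeries.map ψ (relNormTwo hπ E₁ hq G)) =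
    PowerSeries.subst ((ltSer F π).map (algebraMap (LTCoeff F) (unitBall E₂))) (relNormTwo hπ E₂ hq (PowerSeries.map ψ G))
  have e1 : PowerSeries.subst ((ltSer F π).map (algebraMap (LTCoeff F) (unitBall E₂)))
      (PowerSeries.map ψ (relNormTwo hπ E₁ hq G)) = PowerSeries.map ψ (G * reflE hπ E₁ G) := by
    rw [← ringHom_map_subst_map_ltSer hψ, subst_relNormTwo]
  rw [e1, subst_relNormTwo, (PowerSeries.map ψ).map_mul, ringHom_map_reflE hπ hq hψ]

/-! ### Inclusions `E₁ ≤ E₂` -/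

/-- The inclusion `𝒪_{E₁} → 𝒪_{E₂}` fixes `π`. [cite: deShalit1987, Ch. I §1.8] -/
theorem inclUnitBall_algebraMap_pi (h : E₁ ≤ E₂) (a : 𝒪[F]) :
    inclUnitBall (F := F) h (algebraMap 𝒪[F] (unitBall E₁) a) = algebraMap 𝒪[F] (unitBall E₂) a :=
  (inclUnitBall (F := F) h).commutes (LTCoeff.of F a)

/-- **`𝒩_{E₂} (ι G) = ι (𝒩_{E₁} G)`** along `E₁ ≤ E₂`. [cite: deShalit1987, Ch. I §2.1] -/
theorem relNormTwo_map_inclUnitBall (hq : residueFieldCard F = 2) (h : E₁ ≤ E₂) (G : PowerSeries (unitBall E₁)) :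
    relNormTwo hπ E₂ hq (PowerSeries.map (inclUnitBall (F := F) h : unitBall E₁ →+* unitBall E₂) G) =
      PowerSeries.map (inclUnitBall (F := F) h : unitBall E₁ →+* unitBall E₂) (relNormTwo hπ E₁ hq G) :=
  (ringHom_map_relNormTwo hπ hq (ψ := (inclUnitBall (F := F) h : unitBall E₁ →+* unitBall E₂))
    (inclUnitBall_algebraMap_pi h π) G).symm

/-- **`𝒮_{E₂} (ι G) = ι (𝒮_{E₁} G)`** along `E₁ ≤ E₂`. [cite: deShalit1987, Ch. I §3.12] -/
theorem relTraceTwo_map_inclUnitBall (hq : residueFieldCard F = 2) (h : E₁ ≤ E₂) (G : PowerSeries (unitBall E₁)) :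
    relTraceTwo hπ E₂ hq (PowerSeries.map (inclUnitBall (F := F) h : unitBall E₁ →+* unitBall E₂) G) =
      PowerSeries.map (inclUnitBall (F := F) h : unitBall E₁ →+* unitBall E₂) (relTraceTwo hπ E₁ hq G) :=
  (ringHom_map_relTraceTwo hπ hq (ψ := (inclUnitBall (F := F) h : unitBall E₁ →+* unitBall E₂))
    (inclUnitBall_algebraMap_pi h π) G).symm

/-- **The relation `𝒩 G = G^φ` is preserved by `ι : 𝒪_{E₁}⟦X⟧ → 𝒪_{E₂}⟦X⟧`** (`E₁ ≤ E₂` normal over `F`,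
`φ_{E_i}` the restrictions of one `σ₀ ∈ Γ_F`). [cite: deShalit1987, Ch. I §3.10] -/
theorem relNormTwo_map_inclUnitBall_eq_map_frobenius [Normal F E₁] [Normal F E₂] (hq : residueFieldCard F = 2)
    (h : E₁ ≤ E₂) (σ₀ : absoluteGaloisGroup F) {G : PowerSeries (unitBall E₁)}
    (hG : relNormTwo hπ E₁ hq G =
      PowerSeries.map (unitBallEquiv E₁ ((absoluteGaloisGroup.toAlgEquiv F σ₀).restrictNormal E₁) :
        unitBall E₁ →+* unitBall E₁) G) :
    relNormTwo hπ E₂ hq (PowerSeries.map (inclUnitBall (F := F) h : unitBall E₁ →+* unitBall E₂) G) =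
      PowerSeries.map (unitBallEquiv E₂ ((absoluteGaloisGroup.toAlgEquiv F σ₀).restrictNormal E₂) :
        unitBall E₂ →+* unitBall E₂)
        (PowerSeries.map (inclUnitBall (F := F) h : unitBall E₁ →+* unitBall E₂) G) := by
  rw [relNormTwo_map_inclUnitBall hπ hq h, hG, map_inclUnitBall_map_unitBallEquiv_restrictNormal h σ₀ G]

/-- `ι` preserves units and congruences mod `π`: if `G - g ∈ π𝒪_{E₁}⟦X⟧` then `ι G - ι g ∈ π𝒪_{E₂}⟦X⟧`.
[cite: deShalit1987, Ch. I §1.8] -/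
theorem map_inclUnitBall_sub_mem_coeffIdeal (h : E₁ ≤ E₂) {G g : PowerSeries (unitBall E₁)}
    (hGg : G - g ∈ coeffIdeal (Ideal.span {algebraMap 𝒪[F] (unitBall E₁) π})) :
    PowerSeries.map (inclUnitBall (F := F) h : unitBall E₁ →+* unitBall E₂) G -
        PowerSeries.map (inclUnitBall (F := F) h : unitBall E₁ →+* unitBall E₂) g ∈
      coeffIdeal (Ideal.span {algebraMap 𝒪[F] (unitBall E₂) π}) := by
  rw [← map_sub, mem_coeffIdeal_iff]
  intro n
  rw [PowerSeries.coeff_map]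
  obtain ⟨c, hc⟩ := Ideal.mem_span_singleton'.mp (mem_coeffIdeal_iff.mp hGg n)
  rw [← hc, map_mul]
  change inclUnitBall (F := F) h c * inclUnitBall (F := F) h (algebraMap 𝒪[F] (unitBall E₁) π) ∈ _
  rw [inclUnitBall_algebraMap_pi h π]
  exact Ideal.mul_mem_left _ _ (Ideal.mem_span_singleton_self _)

/-- ★★ **Base change of de Shalit's twisted lift** (`q = 2`; `E₁ ≤ E₂` finite normal subextensions of `F̄`,
`σ₀ ∈ Γ_F`, `φ` its restrictions): if `G₁ ∈ 𝒪_{E₁}⟦X⟧` satisfies `𝒩_{E₁} G₁ = G₁^φ`, `G₁ ≡ g (mod π)`, and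
`G₂ ∈ 𝒪_{E₂}⟦X⟧ˣ` satisfies `𝒩_{E₂} G₂ = G₂^φ`, `G₂ ≡ ι g (mod π)`, then `G₂ = ι G₁` — the lift over the
larger unramified coefficient field of a series from the smaller one has coefficients in the smaller one.
[cite: deShalit1987, Ch. I §3.10 Lemma; Ch. III §1.3] -/
theorem frobeniusLift_map_inclUnitBall [Normal F E₁] [Normal F E₂] (hq : residueFieldCard F = 2)
    (h : E₁ ≤ E₂) (σ₀ : absoluteGaloisGroup F) {g G₁ : PowerSeries (unitBall E₁)} {G₂ : PowerSeries (unitBall E₂)}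
    (hG₂u : IsUnit G₂)
    (hN₁ : relNormTwo hπ E₁ hq G₁ =
      PowerSeries.map (unitBallEquiv E₁ ((absoluteGaloisGroup.toAlgEquiv F σ₀).restrictNormal E₁) :
        unitBall E₁ →+* unitBall E₁) G₁)
    (hG₁ : G₁ - g ∈ coeffIdeal (Ideal.span {algebraMap 𝒪[F] (unitBall E₁) π}))
    (hN₂ : relNormTwo hπ E₂ hq G₂ =
      PowerSeries.map (unitBallEquiv E₂ ((absoluteGaloisGroup.toAlgEquiv F σ₀).restrictNormal E₂) :
        unitBall E₂ →+* unitBall E₂) G₂)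
    (hG₂ : G₂ - PowerSeries.map (inclUnitBall (F := F) h : unitBall E₁ →+* unitBall E₂) g ∈
      coeffIdeal (Ideal.span {algebraMap 𝒪[F] (unitBall E₂) π})) :
    G₂ = PowerSeries.map (inclUnitBall (F := F) h : unitBall E₁ →+* unitBall E₂) G₁ := by
  refine (eq_of_relNormTwo_eq_map_frobenius hπ E₂ hq σ₀ hG₂u
    (relNormTwo_map_inclUnitBall_eq_map_frobenius hπ hq h σ₀ hN₁) hN₂ ?_).symm
  -- `ι G₁ - G₂ = (ι G₁ - ι g) - (G₂ - ι g) ∈ π𝒪_{E₂}⟦X⟧`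
  have e : PowerSeries.map (inclUnitBall (F := F) h : unitBall E₁ →+* unitBall E₂) G₁ - G₂ =
      (PowerSeries.map (inclUnitBall (F := F) h : unitBall E₁ →+* unitBall E₂) G₁ -
          PowerSeries.map (inclUnitBall (F := F) h : unitBall E₁ →+* unitBall E₂) g) -
        (G₂ - PowerSeries.map (inclUnitBall (F := F) h : unitBall E₁ →+* unitBall E₂) g) := by ring
  rw [e]
  exact Ideal.sub_mem _ (map_inclUnitBall_sub_mem_coeffIdeal h hG₁) hG₂

/-! ### Units: a series congruent mod `π` to a unit is a unit; the twisted lift as a unique UNIT -/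

/-- **A power series congruent modulo `p` to a unit is a unit**, when `S` is `(p)`-adically complete
(`p` lies in the Jacobson radical, `IsAdicComplete.le_jacobson_bot`; a series is a unit iff its constant
term is). [cite: deShalit1987, Ch. I §3.10 Lemma (proof)] -/
theorem isUnit_of_sub_mem_coeffIdeal_span {S : Type*} [CommRing S] {p : S} [IsAdicComplete (Ideal.span {p}) S]
    {g G : PowerSeries S} (hg : IsUnit g) (h : G - g ∈ coeffIdeal (Ideal.span {p})) : IsUnit G := by
  rw [PowerSeries.isUnit_iff_constantCoeff] at hg ⊢
  have h0 : PowerSeries.constantCoeff G - PowerSeries.constantCoeff g ∈ (⊥ : Ideal S).jacobson := by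
    rw [← map_sub, ← PowerSeries.coeff_zero_eq_constantCoeff_apply]
    exact IsAdicComplete.le_jacobson_bot (Ideal.span {p}) (mem_coeffIdeal_iff.mp h 0)
  obtain ⟨u, hu⟩ := hg
  have h1 : IsUnit ((PowerSeries.constantCoeff G - PowerSeries.constantCoeff g) * ↑u⁻¹ + 1) :=
    Ideal.mem_jacobson_bot.mp h0 _
  have e : PowerSeries.constantCoeff G = ((PowerSeries.constantCoeff G - PowerSeries.constantCoeff g) * ↑u⁻¹ + 1) * u := by
    rw [add_mul, one_mul, mul_assoc, Units.inv_mul, mul_one, hu, sub_add_cancel]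
  rw [e]
  exact h1.mul u.isUnit

variable (E : IntermediateField F (AlgebraicClosure F)) [FiniteDimensional F E]

/-- ★★ **De Shalit's I §3.10 over `𝒪_E` with a UNIT lift, existence and uniqueness** (`q = 2`; `ψ` a ring
automorphism of `𝒪_E` with `ψ(π) = π`, `ψ(c) ≡ c² (mod π)`): for every unit `g` there is exactly one unit `G`
with `𝒩_E G = G^ψ` and `G ≡ g (mod π)`. [cite: deShalit1987, Ch. I §3.10 Lemma] -/
theorem existsUnique_isUnit_relNormTwo_eq_map (hq : residueFieldCard F = 2) (ψ : unitBall E ≃+* unitBall E)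
    (hψ : ψ (algebraMap 𝒪[F] (unitBall E) π) = algebraMap 𝒪[F] (unitBall E) π)
    (hψ2 : ∀ c : unitBall E, ψ c - c ^ 2 ∈ Ideal.span {algebraMap 𝒪[F] (unitBall E) π})
    (g : (PowerSeries (unitBall E))ˣ) :
    ∃! G : PowerSeries (unitBall E), IsUnit G ∧
      relNormTwo hπ E hq G = PowerSeries.map (ψ : unitBall E →+* unitBall E) G ∧
        G - g ∈ coeffIdeal (Ideal.span {algebraMap 𝒪[F] (unitBall E) π}) := by
  haveI := isAdicComplete_span_algebraMap_pi hπ E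
  obtain ⟨G, hN, hG⟩ := exists_relNormTwo_eq_map_sub_mem hπ E hq ψ hψ hψ2 g
  refine ⟨G, ⟨isUnit_of_sub_mem_coeffIdeal_span g.isUnit hG, hN, hG⟩, fun G' hG' => ?_⟩
  refine (eq_of_relNormTwo_eq_map_of_sub_mem hπ E hq ψ hψ hG'.1 hN hG'.2.1 ?_).symm
  have e : G - G' = (G - g) - (G' - g) := by ring
  rw [e]
  exact Ideal.sub_mem _ hG hG'.2.2

/-- ★★★ **The same with the genuine Frobenius** (`E ⊆ F^{nr}` finite normal over `F`, `σ₀ ∈ Γ_F` an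
arithmetic Frobenius, `φ = σ₀|_{𝒪_E}`): for every unit `g ∈ 𝒪_E⟦X⟧ˣ` there is exactly one unit `G` with
`𝒩_E G = G^φ` and `G ≡ g (mod π)`. [cite: deShalit1987, Ch. I §3.10 Lemma] -/
theorem existsUnique_isUnit_relNormTwo_eq_map_frobenius [Normal F E] (hq : residueFieldCard F = 2)
    (hE : E ≤ maxUnramified F) {σ₀ : absoluteGaloisGroup F} (hσ₀ : IsAbsArithFrob σ₀)
    (g : (PowerSeries (unitBall E))ˣ) :
    ∃! G : PowerSeries (unitBall E), IsUnit G ∧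
      relNormTwo hπ E hq G =
          PowerSeries.map (unitBallEquiv E ((absoluteGaloisGroup.toAlgEquiv F σ₀).restrictNormal E) :
            unitBall E →+* unitBall E) G ∧
        G - g ∈ coeffIdeal (Ideal.span {algebraMap 𝒪[F] (unitBall E) π}) :=
  existsUnique_isUnit_relNormTwo_eq_map hπ E hq _ (unitBallEquiv_algebraMap E _ π)
    (fun c => by
      have h := unitBallEquiv_sub_pow_mem hπ E hE hσ₀ _ (coe_restrictNormal_apply E σ₀) c
      rwa [hq] at h) g

end RelativeFunctorial

end Literature.NumberTheory.GaloisRepresentations
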